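import Summits.AtomisticToContinuum.FouriersLaw.Theorems.BondHeatUncertaintyExtensiveSnapshotIrreversibilityEnergyWindowHarmonicCalibration
import Summits.AtomisticToContinuum.FouriersLaw.Theorems.BondHeatUncertaintyExtensiveSnapshotIrreversibilityEnergyWindowSkeletonSurjectivity
import HarnessLib

/-!
# Bond heat uncertainty — node «SkeletonGramFloor»: the skeleton Malliavin-matrix currency
  (MC⁰) typed with the level-uniformity explicit, its regularised form (MC⁰_κ), and the
  HARMONIC CALIBRATION of both (proved)

Cell `decomp-a2c`, lens «grading / quantitative ladder», generation 83.  Lineage crux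
`ExtensiveSnapshotIrreversibility` (K_fix half), leaf S3 `KernelTemperatureLipschitz`; record
(critic rows 1170/1182): S3 ⟸ (Dˢ) ∧ (KD₂), side door (MD₂) `DensityScoreDualBound₂` ⟸ (MW₂)
(parts «HessianSplit» D/E, tree).  Critic row 1182, ruling (4): the skeleton Gaussian-calculus
currency beneath (MD₂) is accepted WITH A CALIBRATION GATE — (g1) TYPE (MC⁰), the inverse moments
of the level-`m` skeleton Gram (= compressed Malliavin) matrix `Γ_m = skelGramPath … s m z wp`
(part S, tree) at a FIXED time `s ∈ [½, 1]`, with the UNIFORMITY IN THE LEVEL `m ≥ m₁` explicit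
and `e^{εH(z)}` the only energy dependence; (g2) DISCHARGE it for the HARMONIC chain as a proved
lemma.  This file does (g1) and (g2).
§1 STATEMENTS.  (MC⁰) `SkeletonGramInverseMoments(Body)`: for `T > 0`, `N ≥ 2`, every `q > 0`,
  `ε > 0` there are `δ₀ > 0`, `C ≥ 0` such that for `|δ| < δ₀`, `s ∈ [½, 1]` and every `z` there
  are ONE level `m₁` and ONE measurable `Λ : Ω → ℝ` with `Λ(wp)|a|² ≤ aᵀ Γ_m(z, wp) a` for ALL
  `m ≥ m₁`, all `wp`, `a`, and `E[Λ^{-q}] ≤ (C e^{εH(z)})^q` with integrand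
  `(ENNReal.ofReal Λ)⁻¹ ^ q` (`Λ ≤ 0` on a non-null set gives `⊤`: no junk escape) — `Λ` is a
  measurable minorant of `inf_{m ≥ m₁} λ_min(Γ_m)`: the level-uniformity sits INSIDE the
  expectation (critic (g1)).  (MC⁰_κ) `SkeletonGramInverseMomentsReg(Body)`: the same for the
  REGULARISED matrices `Γ_m + κ`, every `κ > 0`, `m₁ = m₁(z, κ)`, `C` uniform in `κ` — the form
  the `κ`-regularised weights of part R (`regInv Γ κ`, `κ → 0` after `m → ∞`) consume.
§2 STRUCTURE (proved).  (MC⁰) → (MC⁰_κ) (`skeletonGramInverseMomentsRegBody_of_body`); by the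
  tree's Loewner monotonicity `Γ_{m'} ⪯ Γ_m` (part S) a frame bound at ONE level `m₁` is a frame
  bound at every `m ≥ m₁` with the same `Λ` (`frameBound_mono`, `…Body_of_levelwise`): the
  level-uniformity is free once one level is controlled.
§3 HARMONIC CALIBRATION (proved; `lam = β = 0`, every `ω₂, γ > 0`, every `N ≥ 2`).
  `harmonic_costate_observability` (`c‖λ‖² ≤ ∫₀^{1/2} ((e^{-t𝒢}λ).2 p₀)²`: the tree's
  `costate_eq_zero_of_snd_left`, `V'' = 1`, + `exists_observabilityConstant`);
  `harmonic_gramFloor`: `η |a|² ≤ aᵀ Γ_m(z, wp) a` for ALL `m ≥ m₁`, `|δ| < T`, `s ∈ [½,1]`,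
  `z`, `wp` (`η = γTc/(8N)`; `Γ_m` deterministic by part U; sampling bound of the calibration
  file); ★ `harmonic_skeletonGramInverseMomentsBody` (`δ₀ = T`, `C = η⁻¹`, `Λ ≡ η`) and
  ★ `harmonic_skeletonGramInverseMomentsRegBody`.
NOT HERE: the anharmonic (MC⁰) (critic (g3): Hörmander + Norris/Kusuoka–Stroock bounds, Hairer–
Mattingly 2011 Thm 6.7 shape), (SW⁰₂), the glue to (MD₂).  No short-time rate anywhere (fixed
`s ≥ ½`).  No new instance / notation; no proof holes.  References: D. Nualart, *The Malliavin
Calculus and Related Topics* (2006) §2.3; M. Hairer, J. Mattingly, Electron. J. Probab. 16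
(2011) Thm 6.7; E. D. Sontag, *Mathematical Control Theory* (1998) §6.2; J.-P. Eckmann,
C.-A. Pillet, L. Rey-Bellet, Comm. Math. Phys. 201 (1999) §3.
-/

noncomputable section

namespace Summit.AtomisticToContinuum.FouriersLaw.Theorems.ExtensiveSnapshotIrreversibility.EnergyWindow

open MeasureTheory ProbabilityTheory Filter Topology Set NormedSpace
open scoped ENNReal NNReal Matrix
open Literature.MathematicalPhysics.KineticTheory.HeatConduction
open Literature.Probability.Process Literature.Analysis.ODE

/-! ## 1. The statements (MC⁰) and (MC⁰_κ) -/

section Statements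

/-- The body of **(MC⁰)** at fixed chain parameters: level-uniform inverse moments of the skeleton
Gram matrices `Γ_m = skelGramPath … s m z wp` along the driving path, at a fixed time
`s ∈ [½, 1]`, through ONE measurable frame minorant `Λ` serving every level `m ≥ m₁`
(`Λ |a|² ≤ aᵀΓ_m a`), with `E[Λ^{-q}] ≤ (C e^{εH(z)})^q` (`(ENNReal.ofReal Λ)⁻¹ ^ q`: no junk
value — `Λ ≤ 0` on a non-null set gives `⊤`).  `C` depends on `(T, N, q, ε)` only; `m₁, Λ` on
`(δ, s, z)`. [folklore] -/
def SkeletonGramInverseMomentsBody (ω₂ lam β γ : ℝ) : Prop :=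
  ∀ T : ℝ, 0 < T → ∀ N : ℕ, 2 ≤ N → ∀ q ε : ℝ, 0 < q → 0 < ε →
    ∃ δ₀ C : ℝ, 0 < δ₀ ∧ 0 ≤ C ∧
      ∀ δ : ℝ, |δ| < δ₀ → ∀ s : ℝ, 1 / 2 ≤ s → s ≤ 1 → ∀ z : PhaseSpace N,
        ∃ (m₁ : ℕ) (Λ : WienerPair → ℝ), Measurable Λ ∧
          (∀ m : ℕ, m₁ ≤ m → ∀ (wp : WienerPair) (a : Fin N ⊕ Fin N → ℝ),
            Λ wp * (a ⬝ᵥ a) ≤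
              a ⬝ᵥ (skelGramPath ω₂ lam β γ N (T + δ / 2) (T - δ / 2) s m z wp *ᵥ a)) ∧
          ∫⁻ wp, (ENNReal.ofReal (Λ wp))⁻¹ ^ q ∂wienerPair ≤
            ENNReal.ofReal ((C * Real.exp (ε * (pinnedChain ω₂ lam β γ).hamiltonian N z)) ^ q)

/-- **(MC⁰) `SkeletonGramInverseMoments`** — inverse moments of the level-`m` skeleton Gram
(compressed Malliavin) matrix of the chain driven at both ends, UNIFORMLY IN THE LEVEL `m ≥ m₁`
(one frame minorant `Λ ≤ inf_{m ≥ m₁} λ_min Γ_m` inside the expectation), at a FIXED time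
`s ∈ [½, 1]`, all moments `q < ∞`, the only energy dependence being `e^{εH(z)}` (every `ε > 0`),
uniformly in `|δ| < δ₀`: `E[sup_{m ≥ m₁} λ_min(Γ_m)^{-q}] ≤ (C_q e^{εH(z)})^q`.  Load-bearing
input: the Norris / Kusuoka–Stroock inverse-moment bound for the limiting Malliavin matrix with
sub-exponential growth in the energy (Hairer–Mattingly 2011 Thm 6.7 shape) plus finiteness at one
finite level.  Decided here for the HARMONIC chain (every `N ≥ 2`).  Implies (MC⁰_κ).
[NEW · the critic's (MC⁰) of row 1182 · ATTACKABLE-XL]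
(after Nualart2006, §2.3 Lemma 2.3.1) (after HairerMattingly2011spde, Thm 6.7) [route leaf · named hypothesis of this cell, NOT filed as a route item here] -/
def SkeletonGramInverseMoments : Prop :=
  ∀ ω₂ lam β γ : ℝ, 0 < ω₂ → 0 < lam → 0 < β → 0 < γ →
    SkeletonGramInverseMomentsBody ω₂ lam β γ

/-- The body of **(MC⁰_κ)** at fixed chain parameters: as (MC⁰), for the REGULARISED matrices
`Γ_m + κ·1`, every `κ > 0`, with `m₁ = m₁(δ, s, z, κ)` and `C` uniform in `κ`. [folklore] -/
def SkeletonGramInverseMomentsRegBody (ω₂ lam β γ : ℝ) : Prop :=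
  ∀ T : ℝ, 0 < T → ∀ N : ℕ, 2 ≤ N → ∀ q ε : ℝ, 0 < q → 0 < ε →
    ∃ δ₀ C : ℝ, 0 < δ₀ ∧ 0 ≤ C ∧
      ∀ δ : ℝ, |δ| < δ₀ → ∀ s : ℝ, 1 / 2 ≤ s → s ≤ 1 → ∀ z : PhaseSpace N,
        ∀ κ : ℝ, 0 < κ →
          ∃ (m₁ : ℕ) (Λ : WienerPair → ℝ), Measurable Λ ∧
            (∀ m : ℕ, m₁ ≤ m → ∀ (wp : WienerPair) (a : Fin N ⊕ Fin N → ℝ),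
              Λ wp * (a ⬝ᵥ a) ≤
                a ⬝ᵥ ((skelGramPath ω₂ lam β γ N (T + δ / 2) (T - δ / 2) s m z wp +
                  κ • (1 : Matrix (Fin N ⊕ Fin N) (Fin N ⊕ Fin N) ℝ)) *ᵥ a)) ∧
            ∫⁻ wp, (ENNReal.ofReal (Λ wp))⁻¹ ^ q ∂wienerPair ≤
              ENNReal.ofReal ((C * Real.exp (ε * (pinnedChain ω₂ lam β γ).hamiltonian N z)) ^ q)

/-- **(MC⁰_κ) `SkeletonGramInverseMomentsReg`** — the regularised form of (MC⁰): for every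
`κ > 0`, eventually in the level (`m ≥ m₁(z, κ)`), a measurable frame minorant `Λ` of ALL the
`Γ_m + κ`, `m ≥ m₁`, with `E[Λ^{-q}] ≤ (C e^{εH(z)})^q`, `C` UNIFORM in `κ` (every `q < ∞`, every
`ε > 0`, `s ∈ [½,1]` fixed, `|δ| < δ₀`) — what the level-`m` Hölder step for the
`κ`-regularised Skorokhod weights of part R consumes (`‖(Γ_m+κ)⁻¹‖ ≤ Λ⁻¹`; limit order `m → ∞`
then `κ → 0`).  Implied by (MC⁰); implied by the inverse moments of the monotone LIMIT of the
Gram floors (dominated convergence).  Decided for the harmonic chain.  [NEW · WEAKER than (MC⁰)]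
(after Nualart2006, §2.3 Lemma 2.3.1) (after HairerMattingly2011spde, Thm 6.7) [route leaf · named hypothesis of this cell, NOT filed as a route item here] -/
def SkeletonGramInverseMomentsReg : Prop :=
  ∀ ω₂ lam β γ : ℝ, 0 < ω₂ → 0 < lam → 0 < β → 0 < γ →
    SkeletonGramInverseMomentsRegBody ω₂ lam β γ

/-- (MC⁰) is, by definition, its body at all positive parameters. [folklore] -/
theorem skeletonGramInverseMoments_iff :
    SkeletonGramInverseMoments ↔
      ∀ ω₂ lam β γ : ℝ, 0 < ω₂ → 0 < lam → 0 < β → 0 < γ →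
        SkeletonGramInverseMomentsBody ω₂ lam β γ :=
  Iff.rfl

/-- (MC⁰_κ) is, by definition, its body at all positive parameters. [folklore] -/
theorem skeletonGramInverseMomentsReg_iff :
    SkeletonGramInverseMomentsReg ↔
      ∀ ω₂ lam β γ : ℝ, 0 < ω₂ → 0 < lam → 0 < β → 0 < γ →
        SkeletonGramInverseMomentsRegBody ω₂ lam β γ :=
  Iff.rfl

end Statements

/-! ## 2. Structure: (MC⁰) → (MC⁰_κ); level-uniformity from Loewner monotonicity -/

section Structure

variable {ω₂ lam β γ : ℝ} {N : ℕ}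

/-- `aᵀ(Γ + κ)a = aᵀΓa + κ|a|²`. [folklore] -/
theorem dotProduct_add_smul_one_mulVec (Γ : Matrix (Fin N ⊕ Fin N) (Fin N ⊕ Fin N) ℝ) (κ : ℝ)
    (a : Fin N ⊕ Fin N → ℝ) :
    a ⬝ᵥ ((Γ + κ • (1 : Matrix (Fin N ⊕ Fin N) (Fin N ⊕ Fin N) ℝ)) *ᵥ a) =
      a ⬝ᵥ (Γ *ᵥ a) + κ * (a ⬝ᵥ a) := by
  rw [Matrix.add_mulVec, dotProduct_add, Matrix.smul_mulVec, Matrix.one_mulVec, dotProduct_smul,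
    smul_eq_mul]

/-- **(MC⁰) → (MC⁰_κ)** at fixed parameters (same `δ₀, C, m₁, Λ`; `κ|a|² ≥ 0`). [folklore] -/
theorem skeletonGramInverseMomentsRegBody_of_body (h : SkeletonGramInverseMomentsBody ω₂ lam β γ) :
    SkeletonGramInverseMomentsRegBody ω₂ lam β γ := by
  intro T hT N hN q ε hq hε
  obtain ⟨δ₀, C, hδ₀, hC, hmain⟩ := h T hT N hN q ε hq hε
  refine ⟨δ₀, C, hδ₀, hC, fun δ hδ s hs hs1 z κ hκ => ?_⟩
  obtain ⟨m₁, Λ, hΛ, hframe, hint⟩ := hmain δ hδ s hs hs1 z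
  refine ⟨m₁, Λ, hΛ, fun m hm wp a => ?_, hint⟩
  rw [dotProduct_add_smul_one_mulVec]
  exact (hframe m hm wp a).trans
    (le_add_of_nonneg_right (mul_nonneg hκ.le (dotProduct_self_nonneg_real a)))

/-- **(MC⁰) → (MC⁰_κ).** [folklore] -/
theorem skeletonGramInverseMomentsReg_of_skeletonGramInverseMoments
    (h : SkeletonGramInverseMoments) : SkeletonGramInverseMomentsReg :=
  fun ω₂ lam β γ hω hl hβ hγ => skeletonGramInverseMomentsRegBody_of_body (h ω₂ lam β γ hω hl hβ hγ)

end Structure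

section Mono

variable {ω₂ lam β γ : ℝ} (hω : 0 < ω₂) (hl : 0 ≤ lam) (hβ : 0 ≤ β) (hγ : 0 ≤ γ) (N : ℕ)
  (T_L T_R : ℝ)

include hω hl hβ hγ

/-- **A frame bound at level `m'` is a frame bound at every level `m ≥ m'`** (Loewner
monotonicity `Γ_{m'} ⪯ Γ_m` along the path, part S). [folklore] -/
theorem frameBound_mono {s : ℝ} (hs : s ∈ Icc (0 : ℝ) 1) (z : PhaseSpace N) {m' m : ℕ}
    (hmm : m' ≤ m) {Λ : WienerPair → ℝ}
    (h : ∀ (wp : WienerPair) (a : Fin N ⊕ Fin N → ℝ),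
      Λ wp * (a ⬝ᵥ a) ≤ a ⬝ᵥ (skelGramPath ω₂ lam β γ N T_L T_R s m' z wp *ᵥ a))
    (wp : WienerPair) (a : Fin N ⊕ Fin N → ℝ) :
    Λ wp * (a ⬝ᵥ a) ≤ a ⬝ᵥ (skelGramPath ω₂ lam β γ N T_L T_R s m z wp *ᵥ a) :=
  (h wp a).trans (dotProduct_skelGramPath_mulVec_mono hω hl hβ hγ N T_L T_R hs z wp a hmm)

/-- The same for the regularised matrices `Γ_m + κ`. [folklore] -/
theorem frameBound_reg_mono {s : ℝ} (hs : s ∈ Icc (0 : ℝ) 1) (z : PhaseSpace N) {m' m : ℕ}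
    (hmm : m' ≤ m) (κ : ℝ)
    {Λ : WienerPair → ℝ}
    (h : ∀ (wp : WienerPair) (a : Fin N ⊕ Fin N → ℝ),
      Λ wp * (a ⬝ᵥ a) ≤ a ⬝ᵥ ((skelGramPath ω₂ lam β γ N T_L T_R s m' z wp +
        κ • (1 : Matrix (Fin N ⊕ Fin N) (Fin N ⊕ Fin N) ℝ)) *ᵥ a))
    (wp : WienerPair) (a : Fin N ⊕ Fin N → ℝ) :
    Λ wp * (a ⬝ᵥ a) ≤ a ⬝ᵥ ((skelGramPath ω₂ lam β γ N T_L T_R s m z wp +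
      κ • (1 : Matrix (Fin N ⊕ Fin N) (Fin N ⊕ Fin N) ℝ)) *ᵥ a) := by
  have h1 := h wp a
  rw [dotProduct_add_smul_one_mulVec] at h1 ⊢
  exact h1.trans (add_le_add
    (dotProduct_skelGramPath_mulVec_mono hω hl hβ hγ N T_L T_R hs z wp a hmm) le_rfl)

/-- **The level-uniformity is free**: (MC⁰) follows from its SINGLE-LEVEL version (a frame
bound at the one level `m₁` with the moment bound), by `frameBound_mono`. [folklore] -/
theorem skeletonGramInverseMomentsBody_of_levelwise
    (h : ∀ T : ℝ, 0 < T → ∀ N : ℕ, 2 ≤ N → ∀ q ε : ℝ, 0 < q → 0 < ε →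
      ∃ δ₀ C : ℝ, 0 < δ₀ ∧ 0 ≤ C ∧
        ∀ δ : ℝ, |δ| < δ₀ → ∀ s : ℝ, 1 / 2 ≤ s → s ≤ 1 → ∀ z : PhaseSpace N,
          ∃ (m₁ : ℕ) (Λ : WienerPair → ℝ), Measurable Λ ∧
            (∀ (wp : WienerPair) (a : Fin N ⊕ Fin N → ℝ),
              Λ wp * (a ⬝ᵥ a) ≤
                a ⬝ᵥ (skelGramPath ω₂ lam β γ N (T + δ / 2) (T - δ / 2) s m₁ z wp *ᵥ a)) ∧
            ∫⁻ wp, (ENNReal.ofReal (Λ wp))⁻¹ ^ q ∂wienerPair ≤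
              ENNReal.ofReal
                ((C * Real.exp (ε * (pinnedChain ω₂ lam β γ).hamiltonian N z)) ^ q)) :
    SkeletonGramInverseMomentsBody ω₂ lam β γ := by
  intro T hT N hN q ε hq hε
  obtain ⟨δ₀, C, hδ₀, hC, hmain⟩ := h T hT N hN q ε hq hε
  refine ⟨δ₀, C, hδ₀, hC, fun δ hδ s hs hs1 z => ?_⟩
  obtain ⟨m₁, Λ, hΛ, hframe, hint⟩ := hmain δ hδ s hs hs1 z
  exact ⟨m₁, Λ, hΛ, fun m hm wp a => frameBound_mono hω hl hβ hγ N (T + δ / 2) (T - δ / 2)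
    ⟨by linarith, hs1⟩ z hm hframe wp a, hint⟩

end Mono
/-! ## 3. The harmonic calibration -/

section Observability

variable (ω₂ γ : ℝ) (N : ℕ)

/-- **The harmonic costate is observed through the left-bath momentum on `[0, ½]`**:
`c ‖λ‖² ≤ ∫₀^{1/2} ((e^{-t𝒢} λ).2 p₀)² dt` for one `c > 0` and all `λ`.  The unobservable
subspace is trivial by the tree's linearised observability of the chain through its left end
(`costate_eq_zero_of_snd_left`, `V'' = 1`), and `exists_observabilityConstant` turns that into
the inequality (Sontag §6.2). [folklore] -/
theorem harmonic_costate_observability (hN : 2 ≤ N) :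
    ∃ c : ℝ, 0 < c ∧ ∀ l : PhaseSpace N,
      c * ‖l‖ ^ 2 ≤ ∫ t in (0 : ℝ)..(1 / 2),
        ((exp (t • (-harmCoDriftLin ω₂ γ N)) l).2 (leftBath N hN)) ^ 2 := by
  have hN' : 0 < N := by omega
  have h := exists_observabilityConstant (-harmCoDriftLin ω₂ γ N) (momCLM N (leftBath N hN))
    (τ := 1 / 2) (by norm_num) ?_
  · simpa only [momCLM_apply] using h
  intro X₀ hX
  -- the harmonic costate through `X₀` at time `1/2` solves the costate equation (along `ζ ≡ 0`)
  have hc : ∀ t ∈ Ioo (0 : ℝ) (1 / 2), HasDerivAt (harmCostate ω₂ γ N (1 / 2) X₀)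
      ((pinnedChain ω₂ 0 0 γ).coDrift N ((fun _ : ℝ => (0 : PhaseSpace N)) t)
        (harmCostate ω₂ γ N (1 / 2) X₀ t)) t :=
    fun t _ => hasDerivAt_harmCostate_coDrift ω₂ γ N 0 (1 / 2) X₀ t
  -- and its left-bath momentum component vanishes on `(0, ½)`
  have h0 : ∀ t ∈ Ioo (0 : ℝ) (1 / 2), (harmCostate ω₂ γ N (1 / 2) X₀ t).2 ⟨0, hN'⟩ = 0 := by
    intro t ht
    have h1 : harmCostate ω₂ γ N (1 / 2) X₀ t =
        exp ((1 / 2 - t) • (-harmCoDriftLin ω₂ γ N)) X₀ := by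
      rw [← harmCostate_sub_eq_exp ω₂ γ N (1 / 2) X₀ (1 / 2 - t), sub_sub_cancel]
    have h2 := hX (1 / 2 - t) ⟨by linarith [ht.2], by linarith [ht.1]⟩
    rw [momCLM_apply] at h2
    rwa [h1]
  have hzero := OscillatorChain.costate_eq_zero_of_snd_left (P := pinnedChain ω₂ 0 0 γ)
    (fun r => by rw [harmonic_deriv_deriv_V]; exact one_ne_zero) hN' isOpen_Ioo hc h0
  -- continuity at `t = 1/2`, where the costate equals `X₀`
  have hEq : EqOn (harmCostate ω₂ γ N (1 / 2) X₀) (fun _ => (0 : PhaseSpace N))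
      (closure (Ioo (0 : ℝ) (1 / 2))) :=
    (show EqOn (harmCostate ω₂ γ N (1 / 2) X₀) (fun _ => (0 : PhaseSpace N))
        (Ioo (0 : ℝ) (1 / 2)) from fun t ht => hzero t ht).closure
      (continuous_harmCostate ω₂ γ N (1 / 2) X₀) continuous_const
  have hmem : (1 / 2 : ℝ) ∈ closure (Ioo (0 : ℝ) (1 / 2)) := by
    rw [closure_Ioo (by norm_num : (0 : ℝ) ≠ 1 / 2)]
    exact ⟨by norm_num, le_rfl⟩
  simpa only [harmCostate_self] using hEq hmem

/-- **The window `[0, s]`, `s ≥ ½`, sees at least the observation energy of `[0, ½]`**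
(substitution `t ↦ s − t`: `c_λ(s − u) = e^{-u𝒢}λ`, and monotonicity of the integral of a
nonnegative integrand in the interval). [folklore] -/
theorem harmonic_costate_energy_ge (b : Fin N) {s : ℝ} (hs : 1 / 2 ≤ s) (l : PhaseSpace N) :
    ∫ t in (0 : ℝ)..(1 / 2), ((exp (t • (-harmCoDriftLin ω₂ γ N)) l).2 b) ^ 2 ≤
      ∫ t in (0 : ℝ)..s, ((harmCostate ω₂ γ N s l t).2 b) ^ 2 := by
  have hint : ∫ t in (0 : ℝ)..s, ((exp (t • (-harmCoDriftLin ω₂ γ N)) l).2 b) ^ 2 =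
      ∫ t in (0 : ℝ)..s, ((harmCostate ω₂ γ N s l t).2 b) ^ 2 := by
    have h4 := intervalIntegral.integral_comp_sub_left (a := (0 : ℝ)) (b := s)
      (fun t => ((harmCostate ω₂ γ N s l t).2 b) ^ 2) s
    simp only [sub_self, sub_zero] at h4
    rw [← h4]
    refine intervalIntegral.integral_congr fun t _ => ?_
    show _ = ((harmCostate ω₂ γ N s l (s - t)).2 b) ^ 2
    rw [harmCostate_sub_eq_exp ω₂ γ N s l t]
  rw [← hint]
  have hcont : Continuous fun t : ℝ => ((exp (t • (-harmCoDriftLin ω₂ γ N)) l).2 b) ^ 2 :=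
    ((continuous_apply b).comp (continuous_linearFlow (-harmCoDriftLin ω₂ γ N) l).snd).pow 2
  exact intervalIntegral.integral_mono_interval le_rfl (by norm_num) hs
    (Eventually.of_forall fun t => sq_nonneg _) (hcont.intervalIntegrable _ _)

/-- `|a|² ≤ 2N ‖ofCoordV a‖²` (Euclidean form versus sup norm on phase space). [folklore] -/
theorem dotProduct_self_le_card_mul_norm_sq (a : Fin N ⊕ Fin N → ℝ) :
    a ⬝ᵥ a ≤ 2 * N * ‖ofCoordV N a‖ ^ 2 := by
  have h : ∀ c, a c * a c ≤ ‖ofCoordV N a‖ ^ 2 := by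
    intro c
    have h1 : |a c| ≤ ‖ofCoordV N a‖ := by
      have h2 := abs_coordV_apply_le_norm (ofCoordV N a) c
      rwa [coordV_ofCoordV] at h2
    rw [← abs_mul_abs_self, sq]
    exact mul_le_mul h1 h1 (abs_nonneg _) (norm_nonneg _)
  calc a ⬝ᵥ a = ∑ c, a c * a c := rfl
    _ ≤ ∑ _c : Fin N ⊕ Fin N, ‖ofCoordV N a‖ ^ 2 := Finset.sum_le_sum fun c _ => h c
    _ = 2 * N * ‖ofCoordV N a‖ ^ 2 := by
      rw [Finset.sum_const, Finset.card_univ, Fintype.card_sum, Fintype.card_fin, nsmul_eq_mul]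
      push_cast
      ring

end Observability

section Harmonic

variable {ω₂ γ : ℝ} (hω : 0 < ω₂) (hγ : 0 < γ) (N : ℕ)

include hω hγ

/-- For the harmonic chain the Gram matrix along the path is the deterministic matrix at
`(z, r, x) = (0, 0, 0)` (part U `harmonic_skelJacAt_indep`). [folklore] -/
theorem harmonic_skelGramPath_eq (T_L T_R : ℝ) {s : ℝ} (hs : s ∈ Icc (0 : ℝ) 1) (m : ℕ)
    (z : PhaseSpace N) (wp : WienerPair) :
    skelGramPath ω₂ 0 0 γ N T_L T_R s m z wp = skelGramAt ω₂ 0 0 γ N T_L T_R s m 0 0 0 := by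
  rw [skelGramPath_eq]
  unfold skelGramAt
  rw [harmonic_skelJacAt_indep hω hγ N T_L T_R hs m z 0 (pairRem m wp) 0 (pairSkel m wp) 0]

/-- **The harmonic Gram floor, uniformly in the level.**  For `T > 0`, `N ≥ 2` there are `η > 0`
and a level `m₁` (depending on `ω₂, γ, N, T` only) with
`η |a|² ≤ aᵀ Γ_m(z, wp) a` for ALL `m ≥ m₁`, all `|δ| < T` (baths `T ± δ/2`), all
`s ∈ [½, 1]`, `z`, `wp`, `a`: `η = γ T c /(8N)`, `c` the observability constant; `m₁` is where
the `2^{-m}`-sampling error `e^{2‖𝒢‖}(1 + ‖𝒢‖²) 2^{-m}` drops below `c/4` (the level-`m` discrete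
controllability Gramian converges to the positive-definite continuous one). [folklore] -/
theorem harmonic_gramFloor (hN : 2 ≤ N) {T : ℝ} (hT : 0 < T) :
    ∃ η : ℝ, 0 < η ∧ ∃ m₁ : ℕ, ∀ m : ℕ, m₁ ≤ m → ∀ δ : ℝ, |δ| < T →
      ∀ s : ℝ, 1 / 2 ≤ s → s ≤ 1 →
        ∀ (z : PhaseSpace N) (wp : WienerPair) (a : Fin N ⊕ Fin N → ℝ),
          η * (a ⬝ᵥ a) ≤ a ⬝ᵥ (skelGramPath ω₂ 0 0 γ N (T + δ / 2) (T - δ / 2) s m z wp *ᵥ a) := by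
  obtain ⟨c, hc, hobs⟩ := harmonic_costate_observability ω₂ γ N hN
  have hN0 : (0 : ℝ) < N := by exact_mod_cast (show 0 < N by omega)
  -- the sampling-error coefficient and the level threshold `c₀ 2^{-m} ≤ c/4`
  set c₀ : ℝ := Real.exp ‖harmCoDriftLin ω₂ γ N‖ ^ 2 * (1 + ‖harmCoDriftLin ω₂ γ N‖ ^ 2)
    with hc₀
  have hc₀0 : 0 ≤ c₀ := by positivity
  obtain ⟨m₁, hm₁⟩ := exists_level_le (κ := c / 4) (by positivity) hc₀0
  refine ⟨γ * T * c / (8 * N), by positivity, m₁, fun m hm δ hδ s hs hs1 z wp a => ?_⟩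
  have hTL : 0 < T + δ / 2 := by linarith [(abs_lt.1 hδ).1]
  have hs0 : 0 < s := by linarith
  -- the Gram matrix is deterministic: pass to `(0, 0, 0)` and to the Gram form of part U
  rw [harmonic_skelGramPath_eq hω hγ N (T + δ / 2) (T - δ / 2) ⟨hs0.le, hs1⟩ m z wp,
    ← gramForm_eq_dotProduct a 0 0 0]
  refine le_trans ?_ (harmonic_gramForm_ge_left hω hγ N (T + δ / 2) (T - δ / 2) hN hs0 hs1 m a)
  -- observation energy from below, sampling error from above
  set l : PhaseSpace N := ofCoordV N a with hl
  have hI : c * ‖l‖ ^ 2 ≤ ∫ t in (0 : ℝ)..s,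
      ((harmCostate ω₂ γ N s l t).2 (leftBath N hN)) ^ 2 :=
    (hobs l).trans (harmonic_costate_energy_ge ω₂ γ N (leftBath N hN) hs l)
  have hE : ((2 : ℝ) ^ m)⁻¹ * harmGramErr ω₂ γ N s l ≤ c / 4 * ‖l‖ ^ 2 :=
    calc ((2 : ℝ) ^ m)⁻¹ * harmGramErr ω₂ γ N s l ≤ ((2 : ℝ) ^ m)⁻¹ * (c₀ * ‖l‖ ^ 2) :=
          mul_le_mul_of_nonneg_left (by rw [hc₀]; exact harmGramErr_le ω₂ γ N hs1 l)
            (by positivity)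
      _ = c₀ * ((2 : ℝ) ^ m)⁻¹ * ‖l‖ ^ 2 := by ring
      _ ≤ c / 4 * ‖l‖ ^ 2 := mul_le_mul_of_nonneg_right (hm₁ m hm) (sq_nonneg _)
  have hkey : c / 4 * ‖l‖ ^ 2 ≤ (1 / 2) * (∫ t in (0 : ℝ)..s,
      ((harmCostate ω₂ γ N s l t).2 (leftBath N hN)) ^ 2) -
        ((2 : ℝ) ^ m)⁻¹ * harmGramErr ω₂ γ N s l := by linarith
  have hamp : ampL ω₂ 0 0 γ (T + δ / 2) ^ 2 = 2 * γ * (T + δ / 2) := ampL_sq ω₂ 0 0 hγ.le hTL.le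
  have hcl : 0 ≤ c / 4 * ‖l‖ ^ 2 := by positivity
  calc γ * T * c / (8 * N) * (a ⬝ᵥ a) ≤ γ * T * c / (8 * N) * (2 * N * ‖l‖ ^ 2) :=
        mul_le_mul_of_nonneg_left (dotProduct_self_le_card_mul_norm_sq N a) (by positivity)
    _ = γ * T * (c / 4 * ‖l‖ ^ 2) := by field_simp; ring
    _ ≤ 2 * γ * (T + δ / 2) * (c / 4 * ‖l‖ ^ 2) :=
        mul_le_mul_of_nonneg_right (by nlinarith [(abs_lt.1 hδ).1, hγ]) hcl
    _ ≤ ampL ω₂ 0 0 γ (T + δ / 2) ^ 2 * ((1 / 2) * (∫ t in (0 : ℝ)..s,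
          ((harmCostate ω₂ γ N s l t).2 (leftBath N hN)) ^ 2) -
            ((2 : ℝ) ^ m)⁻¹ * harmGramErr ω₂ γ N s l) := by
        rw [hamp]
        exact mul_le_mul_of_nonneg_left hkey (by positivity)

/-- **HARMONIC CALIBRATION of (MC⁰).**  The harmonic chain (`lam = β = 0`, any `ω₂, γ > 0`)
satisfies the body of (MC⁰) — verbatim the clause shape of §1 — for every `N ≥ 2`, with
`δ₀ = T`, `C = η⁻¹` and the constant minorant `Λ ≡ η` of `harmonic_gramFloor`
(`E[Λ^{-q}] = η^{-q} ≤ (η⁻¹ e^{εH(z)})^q`, `H ≥ 0`) — the witness required by critic row 1182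
(g2): the shape of (MC⁰) is DECIDED on the harmonic chain, uniformly in the level. [folklore] -/
theorem harmonic_skeletonGramInverseMomentsBody : SkeletonGramInverseMomentsBody ω₂ 0 0 γ := by
  intro T hT N hN q ε hq hε
  obtain ⟨η, hη, m₁, hfloor⟩ := harmonic_gramFloor hω hγ N hN hT
  refine ⟨T, η⁻¹, hT, inv_nonneg.2 hη.le, fun δ hδ s hs hs1 z =>
    ⟨m₁, fun _ => η, measurable_const, fun m hm wp a => hfloor m hm δ hδ s hs hs1 z wp a, ?_⟩⟩
  show ∫⁻ _ : WienerPair, (ENNReal.ofReal η)⁻¹ ^ q ∂wienerPair ≤ _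
  rw [lintegral_const, measure_univ, mul_one, ← ENNReal.ofReal_inv_of_pos hη,
    ENNReal.ofReal_rpow_of_nonneg (inv_nonneg.2 hη.le) hq.le]
  have hH : 0 ≤ (pinnedChain ω₂ 0 0 γ).hamiltonian N z :=
    pinnedChain_hamiltonian_nonneg hω.le le_rfl le_rfl γ N z
  exact ENNReal.ofReal_le_ofReal (Real.rpow_le_rpow (inv_nonneg.2 hη.le)
    (le_mul_of_one_le_right (inv_nonneg.2 hη.le) (Real.one_le_exp (mul_nonneg hε.le hH))) hq.le)

/-- **HARMONIC CALIBRATION of (MC⁰_κ)** (from that of (MC⁰)). [folklore] -/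
theorem harmonic_skeletonGramInverseMomentsRegBody : SkeletonGramInverseMomentsRegBody ω₂ 0 0 γ :=
  skeletonGramInverseMomentsRegBody_of_body (harmonic_skeletonGramInverseMomentsBody hω hγ)

end Harmonic

end Summit.AtomisticToContinuum.FouriersLaw.Theorems.ExtensiveSnapshotIrreversibility.EnergyWindow
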